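import Mathlib
import HarnessLib
import Summits.HubbardSuperconductivity.HubbardSuperconductivity.Theorems.KLProgrammeKLRegimeEngineFrameShiftDressingSupFlowGraded
import Summits.HubbardSuperconductivity.HubbardSuperconductivity.Theorems.KLProgrammeKLRegimeEngineFrameShiftDressingFactorTablesGSmall
import Literature.MathematicalPhysics.QuantumLattice.SalmhoferCutoffGevrey
import Literature.MathematicalPhysics.QuantumLattice.SalmhoferCutoffDerivSharp

/-!
# K3 gen-8-FLOW (stmt 20437 `KLRegimeEngineV17F2`, stub (C), «(C)-B-LAST-SIZE» (S1)+(S2)): the GRADED last-step (B) door with the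
# δ-CARRYING defect rows (last-scale regime `Λ_m/4 ≤ |ω₀|`) — and its twin with the cutoff tables as NUMERALS

Cell gate-hubbard-kl, seat p2 g16 (located finding «(C)-B-LAST-SIZE», steps (S1)+(S2)).  `…SupFlowGraded._aliasing_graded` (the last-step (B) door
with GRADED Leibniz summands `2·Σ_{l≤j} C(j,l)·D_q· l·M_{j−l}` and per-order two-leg moments) still reads the six `Md`/order-`0` sup-table binders and
the per-order jets-at-`q` rows `hDqd/hDqa/hDqb : ∀ i ∈ I, ∀ k ≤ j, ‖Dᵏ(factor_i)(q)‖ ≤ D_q· k`.  The Gevrey flow tables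
`norm_iteratedFDeriv_{defect,J₂,J₁}_flowFrame_le_gevrey` (p585557) hold at EVERY order `k ≤ Md`, so the order-`k` binder is discharged by the order-`k`
row DIRECTLY; HERE the defect rows of the tree Leibniz summands are the δ-CARRYING ones of `…DressingFactorTablesGSmall` (one factor
`δ = Gfr₀|U|Θ16^{−m}`), valid under the extra hypothesis `Λ_m/4 ≤ |ω|` for both reading frequencies (true at `m = n_β`: `Λ_{n_β} < 4π/β`,
`|ω₀| = π/β`).  Outputs:
* **`norm_iteratedFDeriv_klLocSelfEnergyRe_flowFrame_sub_le_aliasing_graded_gevrey_small`** — the graded last-step door with δ-carrying defect rows, `A = A′`, `A_J` closed in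
  `(β, L, Λ_m, Md, j, s, X₄, X₀, C_χ, B₁, Ξ, Θ, Φ, Gfr₀|U|)` and the per-order two-leg moments `S k`, `S′ k` (`k ≤ j`), `S_s`, `S′_s`.
* **`norm_iteratedFDeriv_klLocSelfEnergyRe_flowFrame_sub_le_aliasing_graded_gevrey_small_numeral4`** — the same with `B₁ := 4`, `X₄ := 8·576·342⁴`, `X₀ := 8`,
  `C_χ := 342` (`Literature.….SalmhoferCutoffGevrey`, `…SalmhoferCutoffDerivSharp`).
Proofs = one application each; no definitions; nothing asserts superconductivity.  References: BGM 2006 §2.3 (2.21)–(2.24)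
[cite: BenfattoGiulianiMastropietro2006]; Disertori–Rivasseau 2000 §II.2 (II.14) (the cutoff).
-/

noncomputable section

namespace Summit.HubbardSuperconductivity.HubbardSuperconductivity.Theorems.EngineV8

set_option linter.dupNamespace false -- summit = problem name (single-conjunct summit), D-0017

open Real Finset Filter Literature.MathematicalPhysics.QuantumLattice Literature.Probability.LatticeModels GrassmannAlgebra
open Summit.HubbardSuperconductivity.HubbardSuperconductivity.Theorems.KLRegimeSplit
open Summit.HubbardSuperconductivity.HubbardSuperconductivity.Theorems.TwoVolumeDefect
open Summit.HubbardSuperconductivity.HubbardSuperconductivity.Theorems.KLProgrammeLegKernels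
open Summit.HubbardSuperconductivity.HubbardSuperconductivity.Theorems.DispersionFlow
open scoped Nat

variable {L M : ℕ} [NeZero L] [NeZero M]

section Flow

variable {β : ℝ} (hβ : 0 < β) (U μ : ℝ) (m : ℕ)
include hβ

set_option maxHeartbeats 400000 in -- nine table instantiations + the graded last-step door (≈ 200k heartbeats at the default budget's edge)
/-- **THE CORRECTED (B) DOOR AT THE LAST FLOW STEP, GRADED, WITH δ-CARRYING DEFECT ROWS** (last-scale regime `Λ_m/4 ≤ |ω|`): `…_aliasing_graded`
with the six `Md`/order-`0` sup-table numbers, the per-order `J₂`/`J₁` rows of `…DressingFactorTablesG` and the per-order δ-CARRYING defect rows of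
`…DressingFactorTablesGSmall` (`δ·X₀|βL²|(4/Λ_m)((X₀+1)(4/Λ_m)+16(1+C_χ)/Λ_m)·(l!)²·(2ρ_d)ˡ`) for the tree Leibniz summands.  Every constant explicit; the
cutoff enters through `X₄`, `(X₀, C_χ)`, `B₁` only. [cite: BenfattoGiulianiMastropietro2006, §2.3 (2.21)–(2.24)] -/
theorem norm_iteratedFDeriv_klLocSelfEnergyRe_flowFrame_sub_le_aliasing_graded_gevrey_small
    {G : GeoConsts} {Q : EngConsts} {R : RenConsts} (hRG : ∀ j, 0 ≤ R.Gfr j) (hGS : ∀ k, 0 ≤ G.S k) (hQS : ∀ k, 0 ≤ Q.S' k) (hμ : μ ∈ klWindowC)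
    {Nf₁ Nf₂ : ℕ} (hOK₁ : FrameOK R U Nf₁ μ (klFlowFrameU L M β U μ m)) (hOK₂ : FrameOK R U Nf₂ μ (klFlowFrameU L M β U μ (m + 1)))
    {B₁ : ℝ} (hB0 : 0 ≤ B₁) (hB : ∀ y, |deriv salmhoferCutoff y| ≤ B₁)
    {fd : ℝ} (hfdist : frameDist (klFlowFrameU L M β U μ (m + 1)) (klFlowFrameU L M β U μ m) ≤ fd) (hfd : fd ≤ (klScale klE0 m) / 4)
    (hZ₂ : IsUnit (effPartitionFn ℂ (normalCovariance L M (uvSymbolCT L M β μ (klFlowFrameU L M β U μ (m + 1)) (klScale klE0 m))) (hubbardInteraction L M β U + counterQuadratic L M β (klFlowFrameU L M β U μ (m + 1)))))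
    (hZ : ∀ t ∈ Set.Icc (0 : ℝ) 1, effPartitionFn ℂ
      (normalCovariance L M (uvSymbolCT L M β μ (klFlowFrameU L M β U μ m) (klScale klE0 m)) + ((t : ℂ)) • (normalCovariance L M (fun ks => uvSymbolCT L M β μ (klFlowFrameU L M β U μ (m + 1)) (klScale klE0 m) ks / (1 + uvSymbolCT L M β μ (klFlowFrameU L M β U μ (m + 1)) (klScale klE0 m) ks * (((fsub (klFlowFrameU L M β U μ (m + 1)) (klFlowFrameU L M β U μ m)).eval (latticeMomentum L ks.1.2) / (β * (L : ℝ) ^ 2) : ℝ) : ℂ))) - normalCovariance L M (uvSymbolCT L M β μ (klFlowFrameU L M β U μ m) (klScale klE0 m)))) (hubbardInteraction L M β U + counterQuadratic L M β (klFlowFrameU L M β U μ m)) ≠ 0)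
    (j : ℕ) (q : Momentum) {N : ℝ} (hN0 : 0 ≤ N)
    (hN : ∀ t ∈ Set.Icc (0 : ℝ) 1, ∀ i ∈ ({omega0 M, (omega0 M).rev} : Finset (MatsubaraIdx M)), ∀ σ : Fin 2, ∀ Al : HubbardFieldIdx L M,
      |matsubaraFreq β M Al.1.1.1| < (klScale klE0 m) →
      (|nambuXiCT L μ (klFlowFrameU L M β U μ m) Al.1.1.2| < (klScale klE0 m) ∨ |nambuXiCT L μ (klFlowFrameU L M β U μ (m + 1)) Al.1.1.2| < (klScale klE0 m)) →
      ∑ x : TorusSite 2 L, (1 + ((x 0).valMinAbs.natAbs : ℝ) + ((x 1).valMinAbs.natAbs : ℝ)) ^ j * ‖torusFourierInv (fun kv : TorusSite 2 L =>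
        kernel ℂ (effAction ℂ (normalCovariance L M (uvSymbolCT L M β μ (klFlowFrameU L M β U μ m) (klScale klE0 m)) + ((t : ℂ)) • (normalCovariance L M (fun ks => uvSymbolCT L M β μ (klFlowFrameU L M β U μ (m + 1)) (klScale klE0 m) ks / (1 + uvSymbolCT L M β μ (klFlowFrameU L M β U μ (m + 1)) (klScale klE0 m) ks * (((fsub (klFlowFrameU L M β U μ (m + 1)) (klFlowFrameU L M β U μ m)).eval (latticeMomentum L ks.1.2) / (β * (L : ℝ) ^ 2) : ℝ) : ℂ))) - normalCovariance L M (uvSymbolCT L M β μ (klFlowFrameU L M β U μ m) (klScale klE0 m)))) (hubbardInteraction L M β U + counterQuadratic L M β (klFlowFrameU L M β U μ m))) 4 (Fin.snoc (Fin.snoc ![((((i, kv), σ), 0) : HubbardFieldIdx L M), (((i, kv), σ), 1)] (Al.1, 1 - Al.2) : Fin 3 → HubbardFieldIdx L M) Al)) x‖ ≤ N)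
    -- NO `hq₂`/`hq₁`: the reading point need not lie below the shells (last step `m = n_β` included)
    {Md s : ℕ} (hM : 4 + j ≤ Md) {S : ℕ → ℝ} {Ss : ℝ} {S' : ℕ → ℝ} {Ss' : ℝ}
    (hRmom : ∀ t ∈ Set.Icc (0 : ℝ) 1, ∀ i ∈ ({omega0 M, (omega0 M).rev} : Finset (MatsubaraIdx M)), ∀ σ : Fin 2,
      (∀ k ≤ j, ∑ x : TorusSite 2 L, (1 + ((x 0).valMinAbs.natAbs : ℝ) + ((x 1).valMinAbs.natAbs : ℝ)) ^ k * ‖torusFourierInv (fun kv : TorusSite 2 L =>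
        kernel ℂ (effAction ℂ (normalCovariance L M (uvSymbolCT L M β μ (klFlowFrameU L M β U μ m) (klScale klE0 m)) + ((t : ℂ)) • (normalCovariance L M (fun ks => uvSymbolCT L M β μ (klFlowFrameU L M β U μ (m + 1)) (klScale klE0 m) ks / (1 + uvSymbolCT L M β μ (klFlowFrameU L M β U μ (m + 1)) (klScale klE0 m) ks * (((fsub (klFlowFrameU L M β U μ (m + 1)) (klFlowFrameU L M β U μ m)).eval (latticeMomentum L ks.1.2) / (β * (L : ℝ) ^ 2) : ℝ) : ℂ))) - normalCovariance L M (uvSymbolCT L M β μ (klFlowFrameU L M β U μ m) (klScale klE0 m)))) (hubbardInteraction L M β U + counterQuadratic L M β (klFlowFrameU L M β U μ m))) 2 ![((((i, kv), σ), 0) : HubbardFieldIdx L M), (((i, kv), σ), 1)]) x‖ ≤ S k) ∧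
      (∑ x : TorusSite 2 L, (1 + ((x 0).valMinAbs.natAbs : ℝ) + ((x 1).valMinAbs.natAbs : ℝ)) ^ s * ‖torusFourierInv (fun kv : TorusSite 2 L =>
        kernel ℂ (effAction ℂ (normalCovariance L M (uvSymbolCT L M β μ (klFlowFrameU L M β U μ m) (klScale klE0 m)) + ((t : ℂ)) • (normalCovariance L M (fun ks => uvSymbolCT L M β μ (klFlowFrameU L M β U μ (m + 1)) (klScale klE0 m) ks / (1 + uvSymbolCT L M β μ (klFlowFrameU L M β U μ (m + 1)) (klScale klE0 m) ks * (((fsub (klFlowFrameU L M β U μ (m + 1)) (klFlowFrameU L M β U μ m)).eval (latticeMomentum L ks.1.2) / (β * (L : ℝ) ^ 2) : ℝ) : ℂ))) - normalCovariance L M (uvSymbolCT L M β μ (klFlowFrameU L M β U μ m) (klScale klE0 m)))) (hubbardInteraction L M β U + counterQuadratic L M β (klFlowFrameU L M β U μ m))) 2 ![((((i, kv), σ), 0) : HubbardFieldIdx L M), (((i, kv), σ), 1)]) x‖ ≤ Ss))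
    (hSE : ∀ i ∈ ({omega0 M, (omega0 M).rev} : Finset (MatsubaraIdx M)), ∀ σ : Fin 2,
      (∀ k ≤ j, ∑ x : TorusSite 2 L, (1 + ((x 0).valMinAbs.natAbs : ℝ) + ((x 1).valMinAbs.natAbs : ℝ)) ^ k * ‖torusFourierInv (fun kv : TorusSite 2 L =>
        selfEnergy L M β (effAction ℂ (normalCovariance L M (fun ks => uvSymbolCT L M β μ (klFlowFrameU L M β U μ (m + 1)) (klScale klE0 m) ks / (1 + uvSymbolCT L M β μ (klFlowFrameU L M β U μ (m + 1)) (klScale klE0 m) ks * (((fsub (klFlowFrameU L M β U μ (m + 1)) (klFlowFrameU L M β U μ m)).eval (latticeMomentum L ks.1.2) / (β * (L : ℝ) ^ 2) : ℝ) : ℂ)))) (hubbardInteraction L M β U + counterQuadratic L M β (klFlowFrameU L M β U μ m))) (i, kv) σ) x‖ ≤ S' k) ∧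
      (∑ x : TorusSite 2 L, (1 + ((x 0).valMinAbs.natAbs : ℝ) + ((x 1).valMinAbs.natAbs : ℝ)) ^ s * ‖torusFourierInv (fun kv : TorusSite 2 L =>
        selfEnergy L M β (effAction ℂ (normalCovariance L M (fun ks => uvSymbolCT L M β μ (klFlowFrameU L M β U μ (m + 1)) (klScale klE0 m) ks / (1 + uvSymbolCT L M β μ (klFlowFrameU L M β U μ (m + 1)) (klScale klE0 m) ks * (((fsub (klFlowFrameU L M β U μ (m + 1)) (klFlowFrameU L M β U μ m)).eval (latticeMomentum L ks.1.2) / (β * (L : ℝ) ^ 2) : ℝ) : ℂ)))) (hubbardInteraction L M β U + counterQuadratic L M β (klFlowFrameU L M β U μ m))) (i, kv) σ) x‖ ≤ Ss'))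
    -- the Gevrey flow tables (`…EngineFrameShiftDressingFactorTablesG`)
    {X₄ : ℝ} (hX4 : ∀ l ≤ 4, ∀ x : ℝ, ‖iteratedFDeriv ℝ l salmhoferCutoff x‖ ≤ X₄)
    {X₀ Cχ : ℝ} (hX1 : 1 ≤ X₀) (hC : 0 ≤ Cχ) (hXG : ∀ l ≤ Md, ∀ x : ℝ, ‖iteratedFDeriv ℝ l salmhoferCutoff x‖ ≤ X₀ * ((l ! : ℝ)) ^ 2 * Cχ ^ l)
    {n : ℕ} (hP : ∀ m' ≤ n, FlowPieceJetsAt L M β U μ R m') (hTJ : ∀ m' ≤ n, TwoLegReadJetsF L M G Q β U μ m') (hmn : m ≤ n)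
    {Ξ Θ Φ : ℝ} (hΞ0 : 0 ≤ Ξ) (hΘ0 : 0 ≤ Θ) (hΦ0 : 0 ≤ Φ) (hΞ : ∀ i, 1 ≤ i → (if i ≤ 4 then R.Gfr i * uPow i U
      else 2 ^ i * (Real.pi ^ 8 / 4 * 2 ^ (i - 1) * (2 : ℝ) ^ (8 * (i - 1))) *
        ((curveExtC X₄ G.S 1 + curveExtC X₄ Q.S' 1 * |U|) * U ^ 2)) ≤ i ! * Ξ ^ i)
    (hΘΦ : ∀ i : ℕ, (if i ≤ 4 then R.Gfr i * uPow i U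
      else 2 ^ i * (Real.pi ^ 8 / 4 * 2 ^ (i - 1) * (2 : ℝ) ^ (8 * (i - 1))) *
        ((curveExtC X₄ G.S 1 + curveExtC X₄ Q.S' 1 * |U|) * U ^ 2)) ≤ R.Gfr 0 * |U| * Θ * i ! * (2 ^ 10 * Φ) ^ i)
    (hδΛ : (R.Gfr 0 * |U| * Θ * ((16 : ℝ) ^ m)⁻¹) ≤ (klScale klE0 m) / 4)
    -- the last-scale regime: the reading frequencies dominate a quarter of the scale (`m = n_β`: `Λ_m < 4π/β`)
    (hωΛ : ∀ i ∈ ({omega0 M, (omega0 M).rev} : Finset (MatsubaraIdx M)), (klScale klE0 m) / 4 ≤ |matsubaraFreq β M i|) :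
    ‖iteratedFDeriv ℝ j (evalM (symInterp L (fun kv : TorusSite 2 L =>
        klLocSelfEnergyRe L M β U μ (klFlowFrameU L M β U μ (m + 1)) m kv - klLocSelfEnergyRe L M β U μ (klFlowFrameU L M β U μ m) m kv - (fsub (klFlowFrameU L M β U μ (m + 1)) (klFlowFrameU L M β U μ m)).eval (latticeMomentum L kv)))) q‖ ≤
      2 * (2 * (|β| * (L : ℝ) ^ 2) * (12 * (2 * ((klScale klE0 m) * β / Real.pi + 3) *
        ((1793 * (klScale klE0 m) * (L : ℝ) ^ 2 + 704 * L) + (1793 * (klScale klE0 m) * (L : ℝ) ^ 2 + 704 * L)) *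
        (β * (L : ℝ) ^ 2 * (200 + 200 * B₁) / (klScale klE0 m) ^ 2 * fd)) * N)) +
      (4 * ((2 * (∑ l ∈ range (j + 1), (j.choose l : ℝ) * (((R.Gfr 0 * |U| * Θ * ((16 : ℝ) ^ m)⁻¹) * (X₀ * (|(β * (L : ℝ) ^ 2)| * (4 / (klScale klE0 m))) * ((X₀ + 1) * (4 / (klScale klE0 m)) + 16 * (1 + Cχ) / (klScale klE0 m))) * ((l ! : ℝ)) ^ 2 * (2 * (4 * (4 * ((4 + (4 : ℝ) ^ m * Ξ) + (2 ^ 10 * Φ * (4 : ℝ) ^ m)) * (1 + (16 * (1 + Cχ) / (klScale klE0 m)) * (1 + (R.Gfr 0 * |U| * Θ * ((16 : ℝ) ^ m)⁻¹)))) + 4 * (4 * (2 * (4 * (4 + (4 : ℝ) ^ m * Ξ) * (1 + 16 * (1 + Cχ) / (klScale klE0 m) * 1) + (2 ^ 10 * Φ * (4 : ℝ) ^ m))) * (1 + (4 / (klScale klE0 m)) * (1 + (R.Gfr 0 * |U| * Θ * ((16 : ℝ) ^ m)⁻¹) + ((klScale klE0 m) / 128 + X₀ * (R.Gfr 0 *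 |U| * Θ * ((16 : ℝ) ^ m)⁻¹))))) + (4 * ((4 + (4 : ℝ) ^ m * Ξ) + (2 ^ 10 * Φ * (4 : ℝ) ^ m)) * (1 + (4 / (klScale klE0 m)) * (1 + (R.Gfr 0 * |U| * Θ * ((16 : ℝ) ^ m)⁻¹)))) + (4 * (4 + (4 : ℝ) ^ m * Ξ) * (1 + 16 * (1 + Cχ) / (klScale klE0 m) * 1) + (2 ^ 10 * Φ * (4 : ℝ) ^ m)))) ^ l) * (2 * |β| * (L : ℝ) ^ 2 * S (j - l) ^ 2))) + 2 * (2 * ((2 * |β| * (L : ℝ) ^ 2 * S j ^ 2) * ((3 : ℝ) ^ j * (X₀ * (|(β * (L : ℝ) ^ 2)| * (6 / (klScale klE0 m))) * ((Md ! : ℝ)) ^ 2 * (2 * (4 * (2 * (4 * (4 + (4 : ℝ) ^ m * Ξ) * (1 + 16 * (1 + Cχ) / (klScale klE0 m) * 1) + (2 ^ 10 * Φ * (4 : ℝ) ^ m))) * (1 + 6 / (klScale klE0 m) * ((klScale klE0 m) / 128 + X₀ * (R.Gfr 0 * |U| * Θ * ((16 : ℝ) ^ m)⁻¹))))) ^ Md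 +
        X₀ * (|(β * (L : ℝ) ^ 2)| * (2 / (klScale klE0 m))) * ((Md ! : ℝ)) ^ 2 * (4 * ((4 + (4 : ℝ) ^ m * Ξ) + (2 ^ 10 * Φ * (4 : ℝ) ^ m)) * (1 + 2 * (16 * (1 + Cχ) / (klScale klE0 m)) * (1 + (R.Gfr 0 * |U| * Θ * ((16 : ℝ) ^ m)⁻¹)))) ^ Md) * (2 / ((2 * (L / 4 + 1) : ℕ) : ℝ)) ^ (Md - j - 4) * (2 ^ 2 * ∑' k : Fin 2 → ℤ, ∏ c, (1 + (k c : ℝ) ^ 2)⁻¹))))) + (L : ℝ) ^ 2 * (L : ℝ) ^ j * ((X₀ * (|(β * (L : ℝ) ^ 2)| * (6 / (klScale klE0 m))) * ((0 ! : ℝ)) ^ 2 * (2 * (4 * (2 * (4 * (4 + (4 : ℝ) ^ m * Ξ) * (1 + 16 * (1 + Cχ) / (klScale klE0 m) * 1) + (2 ^ 10 * Φ * (4 : ℝ) ^ m))) * (1 + 6 / (klScale klE0 m) * ((klScale klE0 m) / 128 + X₀ * (R.Gfr 0 * |U| * Θ * ((16 : ℝ) ^ m)⁻¹))))) ^ 0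 +
        X₀ * (|(β * (L : ℝ) ^ 2)| * (2 / (klScale klE0 m))) * ((0 ! : ℝ)) ^ 2 * (4 * ((4 + (4 : ℝ) ^ m * Ξ) + (2 ^ 10 * Φ * (4 : ℝ) ^ m)) * (1 + 2 * (16 * (1 + Cχ) / (klScale klE0 m)) * (1 + (R.Gfr 0 * |U| * Θ * ((16 : ℝ) ^ m)⁻¹)))) ^ 0) * ((2 * |β| * (L : ℝ) ^ 2 * Ss ^ 2) / (1 + (L : ℝ) / 4) ^ s)))) + (2 * (2 : ℕ) * (((2 * (∑ l ∈ range (j + 1), (j.choose l : ℝ) * ((((R.Gfr 0 * |U| * Θ * ((16 : ℝ) ^ m)⁻¹) * (R.Gfr 0 * |U| * Θ * ((16 : ℝ) ^ m)⁻¹) / |(β * (L : ℝ) ^ 2)|) * (X₀ * (|(β * (L : ℝ) ^ 2)| * (6 / (klScale klE0 m)))) * ((l ! : ℝ)) ^ 2 * (2 * (2 * (2 ^ 10 * Φ * (4 : ℝ) ^ m) + 2 * (4 * (2 * (4 * (4 + (4 : ℝ) ^ m * Ξ) * (1 + 16 * (1 + Cχ) / (klScale klE0 m) * 1) + (2 ^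 10 * Φ * (4 : ℝ) ^ m))) * (1 + 6 / (klScale klE0 m) * ((klScale klE0 m) / 128 + X₀ * (R.Gfr 0 * |U| * Θ * ((16 : ℝ) ^ m)⁻¹)))))) ^ l) * (1 / 4 : ℝ))) + 2 * (2 * ((1 / 4 : ℝ) * ((3 : ℝ) ^ j * (((R.Gfr 0 * |U| * Θ * ((16 : ℝ) ^ m)⁻¹) * (R.Gfr 0 * |U| * Θ * ((16 : ℝ) ^ m)⁻¹) / |(β * (L : ℝ) ^ 2)|) * (X₀ * (|(β * (L : ℝ) ^ 2)| * (6 / (klScale klE0 m)))) * ((Md ! : ℝ)) ^ 2 * (2 * (2 * (2 ^ 10 * Φ * (4 : ℝ) ^ m) + 2 * (4 * (2 * (4 * (4 + (4 : ℝ) ^ m * Ξ) * (1 + 16 * (1 + Cχ) / (klScale klE0 m) * 1) + (2 ^ 10 * Φ * (4 : ℝ) ^ m))) * (1 + 6 / (klScale klE0 m) * ((klScale klE0 m) / 128 + X₀ * (R.Gfr 0 * |U| * Θ * ((16 : ℝ) ^ m)⁻¹)))))) ^ Md) * (2 / ((2 * (L / 4 + 1) : ℕ) : ℝ)) ^ (Md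 - j - 4) * (2 ^ 2 * ∑' k : Fin 2 → ℤ, ∏ c, (1 + (k c : ℝ) ^ 2)⁻¹))))) + (L : ℝ) ^ 2 * (L : ℝ) ^ j * ((((R.Gfr 0 * |U| * Θ * ((16 : ℝ) ^ m)⁻¹) * (R.Gfr 0 * |U| * Θ * ((16 : ℝ) ^ m)⁻¹) / |(β * (L : ℝ) ^ 2)|) * (X₀ * (|(β * (L : ℝ) ^ 2)| * (6 / (klScale klE0 m)))) * ((0 ! : ℝ)) ^ 2 * (2 * (2 * (2 ^ 10 * Φ * (4 : ℝ) ^ m) + 2 * (4 * (2 * (4 * (4 + (4 : ℝ) ^ m * Ξ) * (1 + 16 * (1 + Cχ) / (klScale klE0 m) * 1) + (2 ^ 10 * Φ * (4 : ℝ) ^ m))) * (1 + 6 / (klScale klE0 m) * ((klScale klE0 m) / 128 + X₀ * (R.Gfr 0 * |U| * Θ * ((16 : ℝ) ^ m)⁻¹)))))) ^ 0) * ((1 / 4 : ℝ) / (1 + (L : ℝ) / 4) ^ s))) + ((2 * (∑ l ∈ range (j + 1), (j.choose l : ℝ) * ((((R.Gfr 0 * |U| * Θ * ((16 : ℝ)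 ^ m)⁻¹) / |(β * (L : ℝ) ^ 2)| * (X₀ * (|(β * (L : ℝ) ^ 2)| * (6 / (klScale klE0 m))))) * ((R.Gfr 0 * |U| * Θ * ((16 : ℝ) ^ m)⁻¹) / |(β * (L : ℝ) ^ 2)| * (X₀ * (|(β * (L : ℝ) ^ 2)| * (6 / (klScale klE0 m))))) * ((l ! : ℝ)) ^ 2 * (2 * (2 * (2 * (2 ^ 10 * Φ * (4 : ℝ) ^ m) + 2 * (4 * (2 * (4 * (4 + (4 : ℝ) ^ m * Ξ) * (1 + 16 * (1 + Cχ) / (klScale klE0 m) * 1) + (2 ^ 10 * Φ * (4 : ℝ) ^ m))) * (1 + 6 / (klScale klE0 m) * ((klScale klE0 m) / 128 + X₀ * (R.Gfr 0 * |U| * Θ * ((16 : ℝ) ^ m)⁻¹))))))) ^ l + 2 * (((R.Gfr 0 * |U| * Θ * ((16 : ℝ) ^ m)⁻¹) / |(β * (L : ℝ) ^ 2)|) * (X₀ * (|(β * (L : ℝ) ^ 2)| * (6 / (klScale klE0 m)))) * ((l ! : ℝ)) ^ 2 * (2 * (2 * (2 ^ 10 * Φ * (4 : ℝ) ^ m)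 + 2 * (4 * (2 * (4 * (4 + (4 : ℝ) ^ m * Ξ) * (1 + 16 * (1 + Cχ) / (klScale klE0 m) * 1) + (2 ^ 10 * Φ * (4 : ℝ) ^ m))) * (1 + 6 / (klScale klE0 m) * ((klScale klE0 m) / 128 + X₀ * (R.Gfr 0 * |U| * Θ * ((16 : ℝ) ^ m)⁻¹)))))) ^ l)) * (1 / 4 * S' (j - l)))) + 2 * (2 * ((1 / 4 * S' j) * ((3 : ℝ) ^ j * (((R.Gfr 0 * |U| * Θ * ((16 : ℝ) ^ m)⁻¹) / |(β * (L : ℝ) ^ 2)| * (X₀ * (|(β * (L : ℝ) ^ 2)| * (6 / (klScale klE0 m))))) * ((R.Gfr 0 * |U| * Θ * ((16 : ℝ) ^ m)⁻¹) / |(β * (L : ℝ) ^ 2)| * (X₀ * (|(β * (L : ℝ) ^ 2)| * (6 / (klScale klE0 m))))) * ((Md ! : ℝ)) ^ 2 * (2 * (2 * (2 * (2 ^ 10 * Φ * (4 : ℝ) ^ m) + 2 * (4 * (2 * (4 * (4 + (4 : ℝ) ^ m * Ξ) * (1 + 16 * (1 + Cχ) / (klScale klE0 m) * 1) + (2 ^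 10 * Φ * (4 : ℝ) ^ m))) * (1 + 6 / (klScale klE0 m) * ((klScale klE0 m) / 128 + X₀ * (R.Gfr 0 * |U| * Θ * ((16 : ℝ) ^ m)⁻¹))))))) ^ Md + 2 * (((R.Gfr 0 * |U| * Θ * ((16 : ℝ) ^ m)⁻¹) / |(β * (L : ℝ) ^ 2)|) * (X₀ * (|(β * (L : ℝ) ^ 2)| * (6 / (klScale klE0 m)))) * ((Md ! : ℝ)) ^ 2 * (2 * (2 * (2 ^ 10 * Φ * (4 : ℝ) ^ m) + 2 * (4 * (2 * (4 * (4 + (4 : ℝ) ^ m * Ξ) * (1 + 16 * (1 + Cχ) / (klScale klE0 m) * 1) + (2 ^ 10 * Φ * (4 : ℝ) ^ m))) * (1 + 6 / (klScale klE0 m) * ((klScale klE0 m) / 128 + X₀ * (R.Gfr 0 * |U| * Θ * ((16 : ℝ) ^ m)⁻¹)))))) ^ Md)) * (2 / ((2 * (L / 4 + 1) : ℕ) : ℝ)) ^ (Md - j - 4) * (2 ^ 2 * ∑' k : Fin 2 → ℤ, ∏ c, (1 + (k c : ℝ) ^ 2)⁻¹))))) + (L : ℝ) ^ 2 * (L :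 ℝ) ^ j * ((((R.Gfr 0 * |U| * Θ * ((16 : ℝ) ^ m)⁻¹) / |(β * (L : ℝ) ^ 2)| * (X₀ * (|(β * (L : ℝ) ^ 2)| * (6 / (klScale klE0 m))))) * ((R.Gfr 0 * |U| * Θ * ((16 : ℝ) ^ m)⁻¹) / |(β * (L : ℝ) ^ 2)| * (X₀ * (|(β * (L : ℝ) ^ 2)| * (6 / (klScale klE0 m))))) * ((0 ! : ℝ)) ^ 2 * (2 * (2 * (2 * (2 ^ 10 * Φ * (4 : ℝ) ^ m) + 2 * (4 * (2 * (4 * (4 + (4 : ℝ) ^ m * Ξ) * (1 + 16 * (1 + Cχ) / (klScale klE0 m) * 1) + (2 ^ 10 * Φ * (4 : ℝ) ^ m))) * (1 + 6 / (klScale klE0 m) * ((klScale klE0 m) / 128 + X₀ * (R.Gfr 0 * |U| * Θ * ((16 : ℝ) ^ m)⁻¹))))))) ^ 0 + 2 * (((R.Gfr 0 * |U| * Θ * ((16 : ℝ) ^ m)⁻¹) / |(β * (L : ℝ) ^ 2)|) * (X₀ * (|(β * (L : ℝ) ^ 2)| * (6 / (klScale klE0 m)))) * ((0 ! : ℝ))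 ^ 2 * (2 * (2 * (2 ^ 10 * Φ * (4 : ℝ) ^ m) + 2 * (4 * (2 * (4 * (4 + (4 : ℝ) ^ m * Ξ) * (1 + 16 * (1 + Cχ) / (klScale klE0 m) * 1) + (2 ^ 10 * Φ * (4 : ℝ) ^ m))) * (1 + 6 / (klScale klE0 m) * ((klScale klE0 m) / 128 + X₀ * (R.Gfr 0 * |U| * Θ * ((16 : ℝ) ^ m)⁻¹)))))) ^ 0)) * ((1 / 4 * Ss') / (1 + (L : ℝ) / 4) ^ s))))) := by
  have hω : ∀ i : MatsubaraIdx M, matsubaraFreq β M i ≠ 0 := fun i => matsubaraFreq_ne_zero hβ.ne' i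
  have hΛ : 0 < (klScale klE0 m) := by unfold klScale klE0; positivity
  have hjM : j ≤ Md := le_trans (Nat.le_add_left j 4) hM
  -- the six sup-table numbers (order `Md` and order `0`)
  have hdD : ∀ i ∈ ({omega0 M, (omega0 M).rev} : Finset (MatsubaraIdx M)), ∀ q' : Momentum, ‖iteratedFDeriv ℝ Md (fun q : Momentum => ((((uvWeightFn (klScale klE0 m) (matsubaraFreq β M i) (frameLevel μ (klFlowFrameU L M β U μ (m + 1)) q) : ℝ) : ℂ) * resolventFnXi (β * (L : ℝ) ^ 2) 0 (matsubaraFreq β M i) (frameLevel μ (klFlowFrameU L M β U μ (m + 1)) q + uvWeightFn (klScale klE0 m) (matsubaraFreq β M i) (frameLevel μ (klFlowFrameU L M β U μ (m + 1)) q) * evalM (fsub (klFlowFrameU L M β U μ (m + 1)) (klFlowFrameU L M β U μ m)) q)) - uvSymbolFnXi (β * (L : ℝ) ^ 2) (klScale klE0 m) (matsubaraFreq β M i) (frameLevel μ (klFlowFrameU L M β U μ (m + 1)) q + evalM (fsub (klFlowFrameU L M β U μ (m + 1)) (klFlowFrameU L M β U μ m)) q))) q'‖ ≤ X₀ * (|(β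 * (L : ℝ) ^ 2)| * (6 / (klScale klE0 m))) * ((Md ! : ℝ)) ^ 2 * (2 * (4 * (2 * (4 * (4 + (4 : ℝ) ^ m * Ξ) * (1 + 16 * (1 + Cχ) / (klScale klE0 m) * 1) + (2 ^ 10 * Φ * (4 : ℝ) ^ m))) * (1 + 6 / (klScale klE0 m) * ((klScale klE0 m) / 128 + X₀ * (R.Gfr 0 * |U| * Θ * ((16 : ℝ) ^ m)⁻¹))))) ^ Md +
        X₀ * (|(β * (L : ℝ) ^ 2)| * (2 / (klScale klE0 m))) * ((Md ! : ℝ)) ^ 2 * (4 * ((4 + (4 : ℝ) ^ m * Ξ) + (2 ^ 10 * Φ * (4 : ℝ) ^ m)) * (1 + 2 * (16 * (1 + Cχ) / (klScale klE0 m)) * (1 + (R.Gfr 0 * |U| * Θ * ((16 : ℝ) ^ m)⁻¹)))) ^ Md :=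
    fun i _ q' => norm_iteratedFDeriv_defect_flowFrame_le_gevrey (hR := hRG) (hGS := hGS) (hQS := hQS) (hμ := hμ) (hX4 := hX4) (hX1 := hX1) (hC := hC) (hXG := hXG) (hP := hP) (hT := hTJ) (hmn := hmn) (hΞ0 := hΞ0) (hΘ0 := hΘ0) (hΦ0 := hΦ0) (hΞ := hΞ) (hΘΦ := hΘΦ) (hδΛ := hδΛ) (hω := hω i) (c := (β * (L : ℝ) ^ 2)) le_rfl q'
  have hdA : ∀ i ∈ ({omega0 M, (omega0 M).rev} : Finset (MatsubaraIdx M)), ∀ q' : Momentum, ‖(fun q : Momentum => ((((uvWeightFn (klScale klE0 m) (matsubaraFreq β M i) (frameLevel μ (klFlowFrameU L M β U μ (m + 1)) q) : ℝ) : ℂ) * resolventFnXi (β * (L : ℝ) ^ 2) 0 (matsubaraFreq β M i) (frameLevel μ (klFlowFrameU L M β U μ (m + 1)) q + uvWeightFn (klScale klE0 m) (matsubaraFreq β M i) (frameLevel μ (klFlowFrameU L M β U μ (m + 1)) q) * evalM (fsub (klFlowFrameU L M β U μ (m + 1)) (klFlowFrameU L M β U μ m)) q)) - uvSymbolFnXi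 (β * (L : ℝ) ^ 2) (klScale klE0 m) (matsubaraFreq β M i) (frameLevel μ (klFlowFrameU L M β U μ (m + 1)) q + evalM (fsub (klFlowFrameU L M β U μ (m + 1)) (klFlowFrameU L M β U μ m)) q))) q'‖ ≤ X₀ * (|(β * (L : ℝ) ^ 2)| * (6 / (klScale klE0 m))) * ((0 ! : ℝ)) ^ 2 * (2 * (4 * (2 * (4 * (4 + (4 : ℝ) ^ m * Ξ) * (1 + 16 * (1 + Cχ) / (klScale klE0 m) * 1) + (2 ^ 10 * Φ * (4 : ℝ) ^ m))) * (1 + 6 / (klScale klE0 m) * ((klScale klE0 m) / 128 + X₀ * (R.Gfr 0 * |U| * Θ * ((16 : ℝ) ^ m)⁻¹))))) ^ 0 +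
        X₀ * (|(β * (L : ℝ) ^ 2)| * (2 / (klScale klE0 m))) * ((0 ! : ℝ)) ^ 2 * (4 * ((4 + (4 : ℝ) ^ m * Ξ) + (2 ^ 10 * Φ * (4 : ℝ) ^ m)) * (1 + 2 * (16 * (1 + Cχ) / (klScale klE0 m)) * (1 + (R.Gfr 0 * |U| * Θ * ((16 : ℝ) ^ m)⁻¹)))) ^ 0 := by
    intro i _ q'
    have h := norm_iteratedFDeriv_defect_flowFrame_le_gevrey (hR := hRG) (hGS := hGS) (hQS := hQS) (hμ := hμ) (hX4 := hX4) (hX1 := hX1) (hC := hC) (hXG := hXG) (hP := hP) (hT := hTJ) (hmn := hmn) (hΞ0 := hΞ0) (hΘ0 := hΘ0) (hΦ0 := hΦ0) (hΞ := hΞ) (hΘΦ := hΘΦ) (hδΛ := hδΛ) (hω := hω i) (c := (β * (L : ℝ) ^ 2)) (Nat.zero_le Md) q'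
    rw [norm_iteratedFDeriv_zero] at h
    exact h
  have haD : ∀ i ∈ ({omega0 M, (omega0 M).rev} : Finset (MatsubaraIdx M)), ∀ q' : Momentum, ‖iteratedFDeriv ℝ Md (fun q : Momentum => (-((((evalM (fsub (klFlowFrameU L M β U μ (m + 1)) (klFlowFrameU L M β U μ m)) q * evalM (fsub (klFlowFrameU L M β U μ (m + 1)) (klFlowFrameU L M β U μ m)) q) / (β * (L : ℝ) ^ 2) : ℝ)) : ℂ) * (((uvWeightFn (klScale klE0 m) (matsubaraFreq β M i) (frameLevel μ (klFlowFrameU L M β U μ (m + 1)) q) : ℝ) : ℂ) * resolventFnXi (β * (L : ℝ) ^ 2) 0 (matsubaraFreq β M i) (frameLevel μ (klFlowFrameU L M β U μ (m + 1)) q + uvWeightFn (klScale klE0 m) (matsubaraFreq β M i) (frameLevel μ (klFlowFrameU L M β U μ (m + 1)) q) * evalM (fsub (klFlowFrameU L M β U μ (m + 1)) (klFlowFrameU L M β U μ m)) q)))) q'‖ ≤ ((R.Gfr 0 * |U| * Θ * ((16 : ℝ) ^ m)⁻¹) * (R.Gfr 0 * |U| * Θ * ((16 : ℝ) ^ m)⁻¹)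 / |(β * (L : ℝ) ^ 2)|) * (X₀ * (|(β * (L : ℝ) ^ 2)| * (6 / (klScale klE0 m)))) * ((Md ! : ℝ)) ^ 2 * (2 * (2 * (2 ^ 10 * Φ * (4 : ℝ) ^ m) + 2 * (4 * (2 * (4 * (4 + (4 : ℝ) ^ m * Ξ) * (1 + 16 * (1 + Cχ) / (klScale klE0 m) * 1) + (2 ^ 10 * Φ * (4 : ℝ) ^ m))) * (1 + 6 / (klScale klE0 m) * ((klScale klE0 m) / 128 + X₀ * (R.Gfr 0 * |U| * Θ * ((16 : ℝ) ^ m)⁻¹)))))) ^ Md :=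
    fun i _ q' => norm_iteratedFDeriv_J₂_flowFrame_le_gevrey (hR := hRG) (hGS := hGS) (hQS := hQS) (hμ := hμ) (hX4 := hX4) (hX1 := hX1) (hC := hC) (hXG := hXG) (hP := hP) (hT := hTJ) (hmn := hmn) (hΞ0 := hΞ0) (hΘ0 := hΘ0) (hΦ0 := hΦ0) (hΞ := hΞ) (hΘΦ := hΘΦ) (hδΛ := hδΛ) (hω := hω i) (c := (β * (L : ℝ) ^ 2)) le_rfl q'
  have haA : ∀ i ∈ ({omega0 M, (omega0 M).rev} : Finset (MatsubaraIdx M)), ∀ q' : Momentum, ‖(fun q : Momentum => (-((((evalM (fsub (klFlowFrameU L M β U μ (m + 1)) (klFlowFrameU L M β U μ m)) q * evalM (fsub (klFlowFrameU L M β U μ (m + 1)) (klFlowFrameU L M β U μ m)) q) / (β * (L : ℝ) ^ 2) : ℝ)) : ℂ) * (((uvWeightFn (klScale klE0 m) (matsubaraFreq β M i) (frameLevel μ (klFlowFrameU L M β U μ (m + 1)) q) : ℝ) : ℂ) * resolventFnXi (β * (L : ℝ) ^ 2) 0 (matsubaraFreq β M i) (frameLevel μ (klFlowFrameU L M β U μ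 (m + 1)) q + uvWeightFn (klScale klE0 m) (matsubaraFreq β M i) (frameLevel μ (klFlowFrameU L M β U μ (m + 1)) q) * evalM (fsub (klFlowFrameU L M β U μ (m + 1)) (klFlowFrameU L M β U μ m)) q)))) q'‖ ≤ ((R.Gfr 0 * |U| * Θ * ((16 : ℝ) ^ m)⁻¹) * (R.Gfr 0 * |U| * Θ * ((16 : ℝ) ^ m)⁻¹) / |(β * (L : ℝ) ^ 2)|) * (X₀ * (|(β * (L : ℝ) ^ 2)| * (6 / (klScale klE0 m)))) * ((0 ! : ℝ)) ^ 2 * (2 * (2 * (2 ^ 10 * Φ * (4 : ℝ) ^ m) + 2 * (4 * (2 * (4 * (4 + (4 : ℝ) ^ m * Ξ) * (1 + 16 * (1 + Cχ) / (klScale klE0 m) * 1) + (2 ^ 10 * Φ * (4 : ℝ) ^ m))) * (1 + 6 / (klScale klE0 m) * ((klScale klE0 m) / 128 + X₀ * (R.Gfr 0 * |U| * Θ * ((16 : ℝ) ^ m)⁻¹)))))) ^ 0 := by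
    intro i _ q'
    have h := norm_iteratedFDeriv_J₂_flowFrame_le_gevrey (hR := hRG) (hGS := hGS) (hQS := hQS) (hμ := hμ) (hX4 := hX4) (hX1 := hX1) (hC := hC) (hXG := hXG) (hP := hP) (hT := hTJ) (hmn := hmn) (hΞ0 := hΞ0) (hΘ0 := hΘ0) (hΦ0 := hΦ0) (hΞ := hΞ) (hΘΦ := hΘΦ) (hδΛ := hδΛ) (hω := hω i) (c := (β * (L : ℝ) ^ 2)) (Nat.zero_le Md) q'
    rw [norm_iteratedFDeriv_zero] at h
    exact h
  have hbD : ∀ i ∈ ({omega0 M, (omega0 M).rev} : Finset (MatsubaraIdx M)), ∀ q' : Momentum, ‖iteratedFDeriv ℝ Md (fun q : Momentum => (((((evalM (fsub (klFlowFrameU L M β U μ (m + 1)) (klFlowFrameU L M β U μ m)) q / (β * (L : ℝ) ^ 2) : ℝ)) : ℂ) * (((uvWeightFn (klScale klE0 m) (matsubaraFreq β M i) (frameLevel μ (klFlowFrameU L M β U μ (m + 1)) q) : ℝ) : ℂ) * resolventFnXi (β * (L : ℝ) ^ 2) 0 (matsubaraFreq β M i) (frameLevel μ (klFlowFrameU L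 M β U μ (m + 1)) q + uvWeightFn (klScale klE0 m) (matsubaraFreq β M i) (frameLevel μ (klFlowFrameU L M β U μ (m + 1)) q) * evalM (fsub (klFlowFrameU L M β U μ (m + 1)) (klFlowFrameU L M β U μ m)) q))) * ((((evalM (fsub (klFlowFrameU L M β U μ (m + 1)) (klFlowFrameU L M β U μ m)) q / (β * (L : ℝ) ^ 2) : ℝ)) : ℂ) * (((uvWeightFn (klScale klE0 m) (matsubaraFreq β M i) (frameLevel μ (klFlowFrameU L M β U μ (m + 1)) q) : ℝ) : ℂ) * resolventFnXi (β * (L : ℝ) ^ 2) 0 (matsubaraFreq β M i) (frameLevel μ (klFlowFrameU L M β U μ (m + 1)) q + uvWeightFn (klScale klE0 m) (matsubaraFreq β M i) (frameLevel μ (klFlowFrameU L M β U μ (m + 1)) q) * evalM (fsub (klFlowFrameU L M β U μ (m + 1)) (klFlowFrameU L M β U μ m)) q))) - (2 : ℂ) * ((((evalM (fsub (klFlowFrameU L M β U μ (m + 1)) (klFlowFrameU L M β U μ m)) q / (β * (L : ℝ) ^ 2) : ℝ)) : ℂ) * (((uvWeightFn (klScale klE0 m) (matsubaraFreq β M i)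 (frameLevel μ (klFlowFrameU L M β U μ (m + 1)) q) : ℝ) : ℂ) * resolventFnXi (β * (L : ℝ) ^ 2) 0 (matsubaraFreq β M i) (frameLevel μ (klFlowFrameU L M β U μ (m + 1)) q + uvWeightFn (klScale klE0 m) (matsubaraFreq β M i) (frameLevel μ (klFlowFrameU L M β U μ (m + 1)) q) * evalM (fsub (klFlowFrameU L M β U μ (m + 1)) (klFlowFrameU L M β U μ m)) q))))) q'‖ ≤ ((R.Gfr 0 * |U| * Θ * ((16 : ℝ) ^ m)⁻¹) / |(β * (L : ℝ) ^ 2)| * (X₀ * (|(β * (L : ℝ) ^ 2)| * (6 / (klScale klE0 m))))) * ((R.Gfr 0 * |U| * Θ * ((16 : ℝ) ^ m)⁻¹) / |(β * (L : ℝ) ^ 2)| * (X₀ * (|(β * (L : ℝ) ^ 2)| * (6 / (klScale klE0 m))))) * ((Md ! : ℝ)) ^ 2 * (2 * (2 * (2 * (2 ^ 10 * Φ * (4 : ℝ) ^ m) + 2 * (4 * (2 * (4 * (4 + (4 : ℝ) ^ m * Ξ) * (1 + 16 * (1 + Cχ) / (klScale klE0 m) * 1) + (2 ^ 10 * Φ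 * (4 : ℝ) ^ m))) * (1 + 6 / (klScale klE0 m) * ((klScale klE0 m) / 128 + X₀ * (R.Gfr 0 * |U| * Θ * ((16 : ℝ) ^ m)⁻¹))))))) ^ Md + 2 * (((R.Gfr 0 * |U| * Θ * ((16 : ℝ) ^ m)⁻¹) / |(β * (L : ℝ) ^ 2)|) * (X₀ * (|(β * (L : ℝ) ^ 2)| * (6 / (klScale klE0 m)))) * ((Md ! : ℝ)) ^ 2 * (2 * (2 * (2 ^ 10 * Φ * (4 : ℝ) ^ m) + 2 * (4 * (2 * (4 * (4 + (4 : ℝ) ^ m * Ξ) * (1 + 16 * (1 + Cχ) / (klScale klE0 m) * 1) + (2 ^ 10 * Φ * (4 : ℝ) ^ m))) * (1 + 6 / (klScale klE0 m) * ((klScale klE0 m) / 128 + X₀ * (R.Gfr 0 * |U| * Θ * ((16 : ℝ) ^ m)⁻¹)))))) ^ Md) :=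
    fun i _ q' => norm_iteratedFDeriv_J₁_flowFrame_le_gevrey (hR := hRG) (hGS := hGS) (hQS := hQS) (hμ := hμ) (hX4 := hX4) (hX1 := hX1) (hC := hC) (hXG := hXG) (hP := hP) (hT := hTJ) (hmn := hmn) (hΞ0 := hΞ0) (hΘ0 := hΘ0) (hΦ0 := hΦ0) (hΞ := hΞ) (hΘΦ := hΘΦ) (hδΛ := hδΛ) (hω := hω i) (c := (β * (L : ℝ) ^ 2)) le_rfl q'
  have hbA : ∀ i ∈ ({omega0 M, (omega0 M).rev} : Finset (MatsubaraIdx M)), ∀ q' : Momentum, ‖(fun q : Momentum => (((((evalM (fsub (klFlowFrameU L M β U μ (m + 1)) (klFlowFrameU L M β U μ m)) q / (β * (L : ℝ) ^ 2) : ℝ)) : ℂ) * (((uvWeightFn (klScale klE0 m) (matsubaraFreq β M i) (frameLevel μ (klFlowFrameU L M β U μ (m + 1)) q) : ℝ) : ℂ) * resolventFnXi (β * (L : ℝ) ^ 2) 0 (matsubaraFreq β M i) (frameLevel μ (klFlowFrameU L M β U μ (m + 1)) q + uvWeightFn (klScale klE0 m) (matsubaraFreq β M i) (frameLevel μ (klFlowFrameU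 L M β U μ (m + 1)) q) * evalM (fsub (klFlowFrameU L M β U μ (m + 1)) (klFlowFrameU L M β U μ m)) q))) * ((((evalM (fsub (klFlowFrameU L M β U μ (m + 1)) (klFlowFrameU L M β U μ m)) q / (β * (L : ℝ) ^ 2) : ℝ)) : ℂ) * (((uvWeightFn (klScale klE0 m) (matsubaraFreq β M i) (frameLevel μ (klFlowFrameU L M β U μ (m + 1)) q) : ℝ) : ℂ) * resolventFnXi (β * (L : ℝ) ^ 2) 0 (matsubaraFreq β M i) (frameLevel μ (klFlowFrameU L M β U μ (m + 1)) q + uvWeightFn (klScale klE0 m) (matsubaraFreq β M i) (frameLevel μ (klFlowFrameU L M β U μ (m + 1)) q) * evalM (fsub (klFlowFrameU L M β U μ (m + 1)) (klFlowFrameU L M β U μ m)) q))) - (2 : ℂ) * ((((evalM (fsub (klFlowFrameU L M β U μ (m + 1)) (klFlowFrameU L M β U μ m)) q / (β * (L : ℝ) ^ 2) : ℝ)) : ℂ) * (((uvWeightFn (klScale klE0 m) (matsubaraFreq β M i) (frameLevel μ (klFlowFrameU L M β U μ (m + 1)) q) : ℝ) : ℂ) * resolventFnXi (β * (L : ℝ)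 ^ 2) 0 (matsubaraFreq β M i) (frameLevel μ (klFlowFrameU L M β U μ (m + 1)) q + uvWeightFn (klScale klE0 m) (matsubaraFreq β M i) (frameLevel μ (klFlowFrameU L M β U μ (m + 1)) q) * evalM (fsub (klFlowFrameU L M β U μ (m + 1)) (klFlowFrameU L M β U μ m)) q))))) q'‖ ≤ ((R.Gfr 0 * |U| * Θ * ((16 : ℝ) ^ m)⁻¹) / |(β * (L : ℝ) ^ 2)| * (X₀ * (|(β * (L : ℝ) ^ 2)| * (6 / (klScale klE0 m))))) * ((R.Gfr 0 * |U| * Θ * ((16 : ℝ) ^ m)⁻¹) / |(β * (L : ℝ) ^ 2)| * (X₀ * (|(β * (L : ℝ) ^ 2)| * (6 / (klScale klE0 m))))) * ((0 ! : ℝ)) ^ 2 * (2 * (2 * (2 * (2 ^ 10 * Φ * (4 : ℝ) ^ m) + 2 * (4 * (2 * (4 * (4 + (4 : ℝ) ^ m * Ξ) * (1 + 16 * (1 + Cχ) / (klScale klE0 m) * 1) + (2 ^ 10 * Φ * (4 : ℝ) ^ m))) * (1 + 6 / (klScale klE0 m) * ((klScale klE0 m) / 128 + X₀ * (R.Gfr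 0 * |U| * Θ * ((16 : ℝ) ^ m)⁻¹))))))) ^ 0 + 2 * (((R.Gfr 0 * |U| * Θ * ((16 : ℝ) ^ m)⁻¹) / |(β * (L : ℝ) ^ 2)|) * (X₀ * (|(β * (L : ℝ) ^ 2)| * (6 / (klScale klE0 m)))) * ((0 ! : ℝ)) ^ 2 * (2 * (2 * (2 ^ 10 * Φ * (4 : ℝ) ^ m) + 2 * (4 * (2 * (4 * (4 + (4 : ℝ) ^ m * Ξ) * (1 + 16 * (1 + Cχ) / (klScale klE0 m) * 1) + (2 ^ 10 * Φ * (4 : ℝ) ^ m))) * (1 + 6 / (klScale klE0 m) * ((klScale klE0 m) / 128 + X₀ * (R.Gfr 0 * |U| * Θ * ((16 : ℝ) ^ m)⁻¹)))))) ^ 0) := by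
    intro i _ q'
    have h := norm_iteratedFDeriv_J₁_flowFrame_le_gevrey (hR := hRG) (hGS := hGS) (hQS := hQS) (hμ := hμ) (hX4 := hX4) (hX1 := hX1) (hC := hC) (hXG := hXG) (hP := hP) (hT := hTJ) (hmn := hmn) (hΞ0 := hΞ0) (hΘ0 := hΘ0) (hΦ0 := hΦ0) (hΞ := hΞ) (hΘΦ := hΘΦ) (hδΛ := hδΛ) (hω := hω i) (c := (β * (L : ℝ) ^ 2)) (Nat.zero_le Md) q'
    rw [norm_iteratedFDeriv_zero] at h
    exact h
  -- the three jets-at-`q` rows, order by order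
  have hdQ : ∀ i ∈ ({omega0 M, (omega0 M).rev} : Finset (MatsubaraIdx M)), ∀ k ≤ j, ‖iteratedFDeriv ℝ k (fun q : Momentum => ((((uvWeightFn (klScale klE0 m) (matsubaraFreq β M i) (frameLevel μ (klFlowFrameU L M β U μ (m + 1)) q) : ℝ) : ℂ) * resolventFnXi (β * (L : ℝ) ^ 2) 0 (matsubaraFreq β M i) (frameLevel μ (klFlowFrameU L M β U μ (m + 1)) q + uvWeightFn (klScale klE0 m) (matsubaraFreq β M i) (frameLevel μ (klFlowFrameU L M β U μ (m + 1)) q) * evalM (fsub (klFlowFrameU L M β U μ (m + 1)) (klFlowFrameU L M β U μ m)) q)) - uvSymbolFnXi (β * (L : ℝ) ^ 2) (klScale klE0 m) (matsubaraFreq β M i) (frameLevel μ (klFlowFrameU L M β U μ (m + 1)) q + evalM (fsub (klFlowFrameU L M β U μ (m + 1)) (klFlowFrameU L M β U μ m)) q))) q‖ ≤ (fun k : ℕ => (R.Gfr 0 * |U| * Θ * ((16 : ℝ) ^ m)⁻¹) * (X₀ * (|(β * (L : ℝ) ^ 2)| * (4 / (klScale klE0 m))) * ((X₀ + 1) * (4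 / (klScale klE0 m)) + 16 * (1 + Cχ) / (klScale klE0 m))) * ((k ! : ℝ)) ^ 2 * (2 * (4 * (4 * ((4 + (4 : ℝ) ^ m * Ξ) + (2 ^ 10 * Φ * (4 : ℝ) ^ m)) * (1 + (16 * (1 + Cχ) / (klScale klE0 m)) * (1 + (R.Gfr 0 * |U| * Θ * ((16 : ℝ) ^ m)⁻¹)))) + 4 * (4 * (2 * (4 * (4 + (4 : ℝ) ^ m * Ξ) * (1 + 16 * (1 + Cχ) / (klScale klE0 m) * 1) + (2 ^ 10 * Φ * (4 : ℝ) ^ m))) * (1 + (4 / (klScale klE0 m)) * (1 + (R.Gfr 0 * |U| * Θ * ((16 : ℝ) ^ m)⁻¹) + ((klScale klE0 m) / 128 + X₀ * (R.Gfr 0 * |U| * Θ * ((16 : ℝ) ^ m)⁻¹))))) + (4 * ((4 + (4 : ℝ) ^ m * Ξ) + (2 ^ 10 * Φ * (4 : ℝ) ^ m)) * (1 + (4 / (klScale klE0 m)) * (1 + (R.Gfr 0 * |U| * Θ * ((16 : ℝ) ^ m)⁻¹)))) + (4 * (4 + (4 : ℝ) ^ m * Ξ) * (1 + 16 * (1 +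 Cχ) / (klScale klE0 m) * 1) + (2 ^ 10 * Φ * (4 : ℝ) ^ m)))) ^ k) k :=
    fun i hi k hk => norm_iteratedFDeriv_defect_flowFrame_le_gevrey_small (hR := hRG) (hGS := hGS) (hQS := hQS) (hμ := hμ) (hX4 := hX4) (hX1 := hX1) (hC := hC) (hXG := hXG) (hP := hP) (hT := hTJ) (hmn := hmn) (hΞ0 := hΞ0) (hΘ0 := hΘ0) (hΦ0 := hΦ0) (hΞ := hΞ) (hΘΦ := hΘΦ) (hωΛ := hωΛ i hi) (c := (β * (L : ℝ) ^ 2)) (show k + 1 ≤ Md by omega) q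
  have haQ : ∀ i ∈ ({omega0 M, (omega0 M).rev} : Finset (MatsubaraIdx M)), ∀ k ≤ j, ‖iteratedFDeriv ℝ k (fun q : Momentum => (-((((evalM (fsub (klFlowFrameU L M β U μ (m + 1)) (klFlowFrameU L M β U μ m)) q * evalM (fsub (klFlowFrameU L M β U μ (m + 1)) (klFlowFrameU L M β U μ m)) q) / (β * (L : ℝ) ^ 2) : ℝ)) : ℂ) * (((uvWeightFn (klScale klE0 m) (matsubaraFreq β M i) (frameLevel μ (klFlowFrameU L M β U μ (m + 1)) q) : ℝ) : ℂ) * resolventFnXi (β * (L : ℝ) ^ 2) 0 (matsubaraFreq β M i) (frameLevel μ (klFlowFrameU L M β U μ (m + 1)) q + uvWeightFn (klScale klE0 m) (matsubaraFreq β M i) (frameLevel μ (klFlowFrameU L M β U μ (m + 1)) q) * evalM (fsub (klFlowFrameU L M β U μ (m + 1)) (klFlowFrameU L M β U μ m)) q)))) q‖ ≤ (fun k : ℕ => ((R.Gfr 0 * |U| * Θ * ((16 : ℝ) ^ m)⁻¹) * (R.Gfr 0 * |U| * Θ * ((16 : ℝ) ^ m)⁻¹) / |(β * (L : ℝ) ^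 2)|) * (X₀ * (|(β * (L : ℝ) ^ 2)| * (6 / (klScale klE0 m)))) * ((k ! : ℝ)) ^ 2 * (2 * (2 * (2 ^ 10 * Φ * (4 : ℝ) ^ m) + 2 * (4 * (2 * (4 * (4 + (4 : ℝ) ^ m * Ξ) * (1 + 16 * (1 + Cχ) / (klScale klE0 m) * 1) + (2 ^ 10 * Φ * (4 : ℝ) ^ m))) * (1 + 6 / (klScale klE0 m) * ((klScale klE0 m) / 128 + X₀ * (R.Gfr 0 * |U| * Θ * ((16 : ℝ) ^ m)⁻¹)))))) ^ k) k :=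
    fun i _ k hk => norm_iteratedFDeriv_J₂_flowFrame_le_gevrey (hR := hRG) (hGS := hGS) (hQS := hQS) (hμ := hμ) (hX4 := hX4) (hX1 := hX1) (hC := hC) (hXG := hXG) (hP := hP) (hT := hTJ) (hmn := hmn) (hΞ0 := hΞ0) (hΘ0 := hΘ0) (hΦ0 := hΦ0) (hΞ := hΞ) (hΘΦ := hΘΦ) (hδΛ := hδΛ) (hω := hω i) (c := (β * (L : ℝ) ^ 2)) (hk.trans hjM) q
  have hbQ : ∀ i ∈ ({omega0 M, (omega0 M).rev} : Finset (MatsubaraIdx M)), ∀ k ≤ j, ‖iteratedFDeriv ℝ k (fun q : Momentum => (((((evalM (fsub (klFlowFrameU L M β U μ (m + 1)) (klFlowFrameU L M β U μ m)) q / (β * (L : ℝ) ^ 2) : ℝ)) : ℂ) * (((uvWeightFn (klScale klE0 m) (matsubaraFreq β M i) (frameLevel μ (klFlowFrameU L M β U μ (m + 1)) q) : ℝ) : ℂ) * resolventFnXi (β * (L : ℝ) ^ 2) 0 (matsubaraFreq β M i) (frameLevel μ (klFlowFrameU L M β U μ (m + 1)) q + uvWeightFn (klScale klE0 m) (matsubaraFreq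 β M i) (frameLevel μ (klFlowFrameU L M β U μ (m + 1)) q) * evalM (fsub (klFlowFrameU L M β U μ (m + 1)) (klFlowFrameU L M β U μ m)) q))) * ((((evalM (fsub (klFlowFrameU L M β U μ (m + 1)) (klFlowFrameU L M β U μ m)) q / (β * (L : ℝ) ^ 2) : ℝ)) : ℂ) * (((uvWeightFn (klScale klE0 m) (matsubaraFreq β M i) (frameLevel μ (klFlowFrameU L M β U μ (m + 1)) q) : ℝ) : ℂ) * resolventFnXi (β * (L : ℝ) ^ 2) 0 (matsubaraFreq β M i) (frameLevel μ (klFlowFrameU L M β U μ (m + 1)) q + uvWeightFn (klScale klE0 m) (matsubaraFreq β M i) (frameLevel μ (klFlowFrameU L M β U μ (m + 1)) q) * evalM (fsub (klFlowFrameU L M β U μ (m + 1)) (klFlowFrameU L M β U μ m)) q))) - (2 : ℂ) * ((((evalM (fsub (klFlowFrameU L M β U μ (m + 1)) (klFlowFrameU L M β U μ m)) q / (β * (L : ℝ) ^ 2) : ℝ)) : ℂ) * (((uvWeightFn (klScale klE0 m) (matsubaraFreq β M i) (frameLevel μ (klFlowFrameU L M β U μ (m + 1)) q) : ℝ) : ℂ)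 * resolventFnXi (β * (L : ℝ) ^ 2) 0 (matsubaraFreq β M i) (frameLevel μ (klFlowFrameU L M β U μ (m + 1)) q + uvWeightFn (klScale klE0 m) (matsubaraFreq β M i) (frameLevel μ (klFlowFrameU L M β U μ (m + 1)) q) * evalM (fsub (klFlowFrameU L M β U μ (m + 1)) (klFlowFrameU L M β U μ m)) q))))) q‖ ≤ (fun k : ℕ => ((R.Gfr 0 * |U| * Θ * ((16 : ℝ) ^ m)⁻¹) / |(β * (L : ℝ) ^ 2)| * (X₀ * (|(β * (L : ℝ) ^ 2)| * (6 / (klScale klE0 m))))) * ((R.Gfr 0 * |U| * Θ * ((16 : ℝ) ^ m)⁻¹) / |(β * (L : ℝ) ^ 2)| * (X₀ * (|(β * (L : ℝ) ^ 2)| * (6 / (klScale klE0 m))))) * ((k ! : ℝ)) ^ 2 * (2 * (2 * (2 * (2 ^ 10 * Φ * (4 : ℝ) ^ m) + 2 * (4 * (2 * (4 * (4 + (4 : ℝ) ^ m * Ξ) * (1 + 16 * (1 + Cχ) / (klScale klE0 m) * 1) + (2 ^ 10 * Φ * (4 : ℝ) ^ m))) * (1 + 6 / (klScale klE0 m) *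 ((klScale klE0 m) / 128 + X₀ * (R.Gfr 0 * |U| * Θ * ((16 : ℝ) ^ m)⁻¹))))))) ^ k + 2 * (((R.Gfr 0 * |U| * Θ * ((16 : ℝ) ^ m)⁻¹) / |(β * (L : ℝ) ^ 2)|) * (X₀ * (|(β * (L : ℝ) ^ 2)| * (6 / (klScale klE0 m)))) * ((k ! : ℝ)) ^ 2 * (2 * (2 * (2 ^ 10 * Φ * (4 : ℝ) ^ m) + 2 * (4 * (2 * (4 * (4 + (4 : ℝ) ^ m * Ξ) * (1 + 16 * (1 + Cχ) / (klScale klE0 m) * 1) + (2 ^ 10 * Φ * (4 : ℝ) ^ m))) * (1 + 6 / (klScale klE0 m) * ((klScale klE0 m) / 128 + X₀ * (R.Gfr 0 * |U| * Θ * ((16 : ℝ) ^ m)⁻¹)))))) ^ k)) k :=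
    fun i _ k hk => norm_iteratedFDeriv_J₁_flowFrame_le_gevrey (hR := hRG) (hGS := hGS) (hQS := hQS) (hμ := hμ) (hX4 := hX4) (hX1 := hX1) (hC := hC) (hXG := hXG) (hP := hP) (hT := hTJ) (hmn := hmn) (hΞ0 := hΞ0) (hΘ0 := hΘ0) (hΦ0 := hΦ0) (hΞ := hΞ) (hΘΦ := hΘΦ) (hδΛ := hδΛ) (hω := hω i) (c := (β * (L : ℝ) ^ 2)) (hk.trans hjM) q
  have h := norm_iteratedFDeriv_klLocSelfEnergyRe_flowFrame_sub_le_aliasing_graded hβ U μ m hOK₁ hOK₂ hB0 hB hfdist hfd hZ₂ hZ j q hN0 hN hM hRmom hSE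
    hdD hdA haD haA hbD hbA hdQ haQ hbQ
  rw [add_self_div_two] at h
  exact h

/-- **THE CORRECTED (B) DOOR AT THE LAST FLOW STEP, GRADED, δ-CARRYING DEFECT ROWS, CUTOFF TABLES AS NUMERALS** (`B₁ = 4`, `X₄ = 8·576·342⁴`,
`(X₀, C_χ) = (8, 342)`): `…_aliasing_graded_gevrey_small` with `hB0 hB hX4 hX1 hC hXG` discharged by `Literature.….SalmhoferCutoffGevrey` / `…SalmhoferCutoffDerivSharp` — the graded
twin of `…_aliasing_last_gevrey_numeral4`: Leibniz summands `2·Σ_{l≤j} C(j,l)·Row_x(l)·M_{j−l}` with `M_k = 2|β|L²S_k²`, `¼`, `¼S′_k` (inputs left: the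
door's own, the flow history, the envelope parameters `(Ξ, Θ, Φ)` with their two `m`-free piece-table hypotheses and `Gfr₀|U|Θ16^{−m} ≤ Λ_m/4`, and the
per-order two-leg moments). [cite: BenfattoGiulianiMastropietro2006, §2.3 (2.21)–(2.24)] -/
theorem norm_iteratedFDeriv_klLocSelfEnergyRe_flowFrame_sub_le_aliasing_graded_gevrey_small_numeral4
    {G : GeoConsts} {Q : EngConsts} {R : RenConsts} (hRG : ∀ j, 0 ≤ R.Gfr j) (hGS : ∀ k, 0 ≤ G.S k) (hQS : ∀ k, 0 ≤ Q.S' k) (hμ : μ ∈ klWindowC)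
    {Nf₁ Nf₂ : ℕ} (hOK₁ : FrameOK R U Nf₁ μ (klFlowFrameU L M β U μ m)) (hOK₂ : FrameOK R U Nf₂ μ (klFlowFrameU L M β U μ (m + 1)))
    {fd : ℝ} (hfdist : frameDist (klFlowFrameU L M β U μ (m + 1)) (klFlowFrameU L M β U μ m) ≤ fd) (hfd : fd ≤ (klScale klE0 m) / 4)
    (hZ₂ : IsUnit (effPartitionFn ℂ (normalCovariance L M (uvSymbolCT L M β μ (klFlowFrameU L M β U μ (m + 1)) (klScale klE0 m))) (hubbardInteraction L M β U + counterQuadratic L M β (klFlowFrameU L M β U μ (m + 1)))))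
    (hZ : ∀ t ∈ Set.Icc (0 : ℝ) 1, effPartitionFn ℂ
      (normalCovariance L M (uvSymbolCT L M β μ (klFlowFrameU L M β U μ m) (klScale klE0 m)) + ((t : ℂ)) • (normalCovariance L M (fun ks => uvSymbolCT L M β μ (klFlowFrameU L M β U μ (m + 1)) (klScale klE0 m) ks / (1 + uvSymbolCT L M β μ (klFlowFrameU L M β U μ (m + 1)) (klScale klE0 m) ks * (((fsub (klFlowFrameU L M β U μ (m + 1)) (klFlowFrameU L M β U μ m)).eval (latticeMomentum L ks.1.2) / (β * (L : ℝ) ^ 2) : ℝ) : ℂ))) - normalCovariance L M (uvSymbolCT L M β μ (klFlowFrameU L M β U μ m) (klScale klE0 m)))) (hubbardInteraction L M β U + counterQuadratic L M β (klFlowFrameU L M β U μ m)) ≠ 0)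
    (j : ℕ) (q : Momentum) {N : ℝ} (hN0 : 0 ≤ N)
    (hN : ∀ t ∈ Set.Icc (0 : ℝ) 1, ∀ i ∈ ({omega0 M, (omega0 M).rev} : Finset (MatsubaraIdx M)), ∀ σ : Fin 2, ∀ Al : HubbardFieldIdx L M,
      |matsubaraFreq β M Al.1.1.1| < (klScale klE0 m) →
      (|nambuXiCT L μ (klFlowFrameU L M β U μ m) Al.1.1.2| < (klScale klE0 m) ∨ |nambuXiCT L μ (klFlowFrameU L M β U μ (m + 1)) Al.1.1.2| < (klScale klE0 m)) →
      ∑ x : TorusSite 2 L, (1 + ((x 0).valMinAbs.natAbs : ℝ) + ((x 1).valMinAbs.natAbs : ℝ)) ^ j * ‖torusFourierInv (fun kv : TorusSite 2 L =>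
        kernel ℂ (effAction ℂ (normalCovariance L M (uvSymbolCT L M β μ (klFlowFrameU L M β U μ m) (klScale klE0 m)) + ((t : ℂ)) • (normalCovariance L M (fun ks => uvSymbolCT L M β μ (klFlowFrameU L M β U μ (m + 1)) (klScale klE0 m) ks / (1 + uvSymbolCT L M β μ (klFlowFrameU L M β U μ (m + 1)) (klScale klE0 m) ks * (((fsub (klFlowFrameU L M β U μ (m + 1)) (klFlowFrameU L M β U μ m)).eval (latticeMomentum L ks.1.2) / (β * (L : ℝ) ^ 2) : ℝ) : ℂ))) - normalCovariance L M (uvSymbolCT L M β μ (klFlowFrameU L M β U μ m) (klScale klE0 m)))) (hubbardInteraction L M β U + counterQuadratic L M β (klFlowFrameU L M β U μ m))) 4 (Fin.snoc (Fin.snoc ![((((i, kv), σ), 0) : HubbardFieldIdx L M), (((i, kv), σ), 1)] (Al.1, 1 - Al.2) : Fin 3 → HubbardFieldIdx L M) Al)) x‖ ≤ N)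
    -- NO `hq₂`/`hq₁`: the reading point need not lie below the shells (last step `m = n_β` included)
    {Md s : ℕ} (hM : 4 + j ≤ Md) {S : ℕ → ℝ} {Ss : ℝ} {S' : ℕ → ℝ} {Ss' : ℝ}
    (hRmom : ∀ t ∈ Set.Icc (0 : ℝ) 1, ∀ i ∈ ({omega0 M, (omega0 M).rev} : Finset (MatsubaraIdx M)), ∀ σ : Fin 2,
      (∀ k ≤ j, ∑ x : TorusSite 2 L, (1 + ((x 0).valMinAbs.natAbs : ℝ) + ((x 1).valMinAbs.natAbs : ℝ)) ^ k * ‖torusFourierInv (fun kv : TorusSite 2 L =>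
        kernel ℂ (effAction ℂ (normalCovariance L M (uvSymbolCT L M β μ (klFlowFrameU L M β U μ m) (klScale klE0 m)) + ((t : ℂ)) • (normalCovariance L M (fun ks => uvSymbolCT L M β μ (klFlowFrameU L M β U μ (m + 1)) (klScale klE0 m) ks / (1 + uvSymbolCT L M β μ (klFlowFrameU L M β U μ (m + 1)) (klScale klE0 m) ks * (((fsub (klFlowFrameU L M β U μ (m + 1)) (klFlowFrameU L M β U μ m)).eval (latticeMomentum L ks.1.2) / (β * (L : ℝ) ^ 2) : ℝ) : ℂ))) - normalCovariance L M (uvSymbolCT L M β μ (klFlowFrameU L M β U μ m) (klScale klE0 m)))) (hubbardInteraction L M β U + counterQuadratic L M β (klFlowFrameU L M β U μ m))) 2 ![((((i, kv), σ), 0) : HubbardFieldIdx L M), (((i, kv), σ), 1)]) x‖ ≤ S k) ∧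
      (∑ x : TorusSite 2 L, (1 + ((x 0).valMinAbs.natAbs : ℝ) + ((x 1).valMinAbs.natAbs : ℝ)) ^ s * ‖torusFourierInv (fun kv : TorusSite 2 L =>
        kernel ℂ (effAction ℂ (normalCovariance L M (uvSymbolCT L M β μ (klFlowFrameU L M β U μ m) (klScale klE0 m)) + ((t : ℂ)) • (normalCovariance L M (fun ks => uvSymbolCT L M β μ (klFlowFrameU L M β U μ (m + 1)) (klScale klE0 m) ks / (1 + uvSymbolCT L M β μ (klFlowFrameU L M β U μ (m + 1)) (klScale klE0 m) ks * (((fsub (klFlowFrameU L M β U μ (m + 1)) (klFlowFrameU L M β U μ m)).eval (latticeMomentum L ks.1.2) / (β * (L : ℝ) ^ 2) : ℝ) : ℂ))) - normalCovariance L M (uvSymbolCT L M β μ (klFlowFrameU L M β U μ m) (klScale klE0 m)))) (hubbardInteraction L M β U + counterQuadratic L M β (klFlowFrameU L M β U μ m))) 2 ![((((i, kv), σ), 0) : HubbardFieldIdx L M), (((i, kv), σ), 1)]) x‖ ≤ Ss))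
    (hSE : ∀ i ∈ ({omega0 M, (omega0 M).rev} : Finset (MatsubaraIdx M)), ∀ σ : Fin 2,
      (∀ k ≤ j, ∑ x : TorusSite 2 L, (1 + ((x 0).valMinAbs.natAbs : ℝ) + ((x 1).valMinAbs.natAbs : ℝ)) ^ k * ‖torusFourierInv (fun kv : TorusSite 2 L =>
        selfEnergy L M β (effAction ℂ (normalCovariance L M (fun ks => uvSymbolCT L M β μ (klFlowFrameU L M β U μ (m + 1)) (klScale klE0 m) ks / (1 + uvSymbolCT L M β μ (klFlowFrameU L M β U μ (m + 1)) (klScale klE0 m) ks * (((fsub (klFlowFrameU L M β U μ (m + 1)) (klFlowFrameU L M β U μ m)).eval (latticeMomentum L ks.1.2) / (β * (L : ℝ) ^ 2) : ℝ) : ℂ)))) (hubbardInteraction L M β U + counterQuadratic L M β (klFlowFrameU L M β U μ m))) (i, kv) σ) x‖ ≤ S' k) ∧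
      (∑ x : TorusSite 2 L, (1 + ((x 0).valMinAbs.natAbs : ℝ) + ((x 1).valMinAbs.natAbs : ℝ)) ^ s * ‖torusFourierInv (fun kv : TorusSite 2 L =>
        selfEnergy L M β (effAction ℂ (normalCovariance L M (fun ks => uvSymbolCT L M β μ (klFlowFrameU L M β U μ (m + 1)) (klScale klE0 m) ks / (1 + uvSymbolCT L M β μ (klFlowFrameU L M β U μ (m + 1)) (klScale klE0 m) ks * (((fsub (klFlowFrameU L M β U μ (m + 1)) (klFlowFrameU L M β U μ m)).eval (latticeMomentum L ks.1.2) / (β * (L : ℝ) ^ 2) : ℝ) : ℂ)))) (hubbardInteraction L M β U + counterQuadratic L M β (klFlowFrameU L M β U μ m))) (i, kv) σ) x‖ ≤ Ss'))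
    -- the flow history and the envelope parameters (the cutoff tables are numerals)
    {n : ℕ} (hP : ∀ m' ≤ n, FlowPieceJetsAt L M β U μ R m') (hTJ : ∀ m' ≤ n, TwoLegReadJetsF L M G Q β U μ m') (hmn : m ≤ n)
    {Ξ Θ Φ : ℝ} (hΞ0 : 0 ≤ Ξ) (hΘ0 : 0 ≤ Θ) (hΦ0 : 0 ≤ Φ) (hΞ : ∀ i, 1 ≤ i → (if i ≤ 4 then R.Gfr i * uPow i U
      else 2 ^ i * (Real.pi ^ 8 / 4 * 2 ^ (i - 1) * (2 : ℝ) ^ (8 * (i - 1))) *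
        ((curveExtC (8 * 576 * (342 : ℝ) ^ 4) G.S 1 + curveExtC (8 * 576 * (342 : ℝ) ^ 4) Q.S' 1 * |U|) * U ^ 2)) ≤ i ! * Ξ ^ i)
    (hΘΦ : ∀ i : ℕ, (if i ≤ 4 then R.Gfr i * uPow i U
      else 2 ^ i * (Real.pi ^ 8 / 4 * 2 ^ (i - 1) * (2 : ℝ) ^ (8 * (i - 1))) *
        ((curveExtC (8 * 576 * (342 : ℝ) ^ 4) G.S 1 + curveExtC (8 * 576 * (342 : ℝ) ^ 4) Q.S' 1 * |U|) * U ^ 2)) ≤ R.Gfr 0 * |U| * Θ * i ! * (2 ^ 10 * Φ) ^ i)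
    (hδΛ : (R.Gfr 0 * |U| * Θ * ((16 : ℝ) ^ m)⁻¹) ≤ (klScale klE0 m) / 4)
    -- the last-scale regime: the reading frequencies dominate a quarter of the scale (`m = n_β`: `Λ_m < 4π/β`)
    (hωΛ : ∀ i ∈ ({omega0 M, (omega0 M).rev} : Finset (MatsubaraIdx M)), (klScale klE0 m) / 4 ≤ |matsubaraFreq β M i|) :
    ‖iteratedFDeriv ℝ j (evalM (symInterp L (fun kv : TorusSite 2 L =>
        klLocSelfEnergyRe L M β U μ (klFlowFrameU L M β U μ (m + 1)) m kv - klLocSelfEnergyRe L M β U μ (klFlowFrameU L M β U μ m) m kv - (fsub (klFlowFrameU L M β U μ (m + 1)) (klFlowFrameU L M β U μ m)).eval (latticeMomentum L kv)))) q‖ ≤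
      2 * (2 * (|β| * (L : ℝ) ^ 2) * (12 * (2 * ((klScale klE0 m) * β / Real.pi + 3) *
        ((1793 * (klScale klE0 m) * (L : ℝ) ^ 2 + 704 * L) + (1793 * (klScale klE0 m) * (L : ℝ) ^ 2 + 704 * L)) *
        (β * (L : ℝ) ^ 2 * (200 + 200 * 4) / (klScale klE0 m) ^ 2 * fd)) * N)) +
      (4 * ((2 * (∑ l ∈ range (j + 1), (j.choose l : ℝ) * (((R.Gfr 0 * |U| * Θ * ((16 : ℝ) ^ m)⁻¹) * (8 * (|(β * (L : ℝ) ^ 2)| * (4 / (klScale klE0 m))) * ((8 + 1) * (4 / (klScale klE0 m)) + 16 * (1 + 342) / (klScale klE0 m))) * ((l ! : ℝ)) ^ 2 * (2 * (4 * (4 * ((4 + (4 : ℝ) ^ m * Ξ) + (2 ^ 10 * Φ * (4 : ℝ) ^ m)) * (1 + (16 * (1 + 342) / (klScale klE0 m)) * (1 + (R.Gfr 0 * |U| * Θ * ((16 : ℝ) ^ m)⁻¹)))) + 4 * (4 * (2 * (4 * (4 + (4 : ℝ) ^ m * Ξ) * (1 + 16 * (1 + 342) / (klScale klE0 m) * 1)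 + (2 ^ 10 * Φ * (4 : ℝ) ^ m))) * (1 + (4 / (klScale klE0 m)) * (1 + (R.Gfr 0 * |U| * Θ * ((16 : ℝ) ^ m)⁻¹) + ((klScale klE0 m) / 128 + 8 * (R.Gfr 0 * |U| * Θ * ((16 : ℝ) ^ m)⁻¹))))) + (4 * ((4 + (4 : ℝ) ^ m * Ξ) + (2 ^ 10 * Φ * (4 : ℝ) ^ m)) * (1 + (4 / (klScale klE0 m)) * (1 + (R.Gfr 0 * |U| * Θ * ((16 : ℝ) ^ m)⁻¹)))) + (4 * (4 + (4 : ℝ) ^ m * Ξ) * (1 + 16 * (1 + 342) / (klScale klE0 m) * 1) + (2 ^ 10 * Φ * (4 : ℝ) ^ m)))) ^ l) * (2 * |β| * (L : ℝ) ^ 2 * S (j - l) ^ 2))) + 2 * (2 * ((2 * |β| * (L : ℝ) ^ 2 * S j ^ 2) * ((3 : ℝ) ^ j * (8 * (|(β * (L : ℝ) ^ 2)| * (6 / (klScale klE0 m))) * ((Md ! : ℝ)) ^ 2 * (2 * (4 * (2 * (4 * (4 + (4 : ℝ) ^ m * Ξ) * (1 + 16 * (1 + 342) / (klScale klE0 m)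 * 1) + (2 ^ 10 * Φ * (4 : ℝ) ^ m))) * (1 + 6 / (klScale klE0 m) * ((klScale klE0 m) / 128 + 8 * (R.Gfr 0 * |U| * Θ * ((16 : ℝ) ^ m)⁻¹))))) ^ Md +
        8 * (|(β * (L : ℝ) ^ 2)| * (2 / (klScale klE0 m))) * ((Md ! : ℝ)) ^ 2 * (4 * ((4 + (4 : ℝ) ^ m * Ξ) + (2 ^ 10 * Φ * (4 : ℝ) ^ m)) * (1 + 2 * (16 * (1 + 342) / (klScale klE0 m)) * (1 + (R.Gfr 0 * |U| * Θ * ((16 : ℝ) ^ m)⁻¹)))) ^ Md) * (2 / ((2 * (L / 4 + 1) : ℕ) : ℝ)) ^ (Md - j - 4) * (2 ^ 2 * ∑' k : Fin 2 → ℤ, ∏ c, (1 + (k c : ℝ) ^ 2)⁻¹))))) + (L : ℝ) ^ 2 * (L : ℝ) ^ j * ((8 * (|(β * (L : ℝ) ^ 2)| * (6 / (klScale klE0 m))) * ((0 ! : ℝ)) ^ 2 * (2 * (4 * (2 * (4 * (4 + (4 : ℝ) ^ m * Ξ) * (1 + 16 * (1 + 342) / (klScale klE0 m) * 1) + (2 ^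 10 * Φ * (4 : ℝ) ^ m))) * (1 + 6 / (klScale klE0 m) * ((klScale klE0 m) / 128 + 8 * (R.Gfr 0 * |U| * Θ * ((16 : ℝ) ^ m)⁻¹))))) ^ 0 +
        8 * (|(β * (L : ℝ) ^ 2)| * (2 / (klScale klE0 m))) * ((0 ! : ℝ)) ^ 2 * (4 * ((4 + (4 : ℝ) ^ m * Ξ) + (2 ^ 10 * Φ * (4 : ℝ) ^ m)) * (1 + 2 * (16 * (1 + 342) / (klScale klE0 m)) * (1 + (R.Gfr 0 * |U| * Θ * ((16 : ℝ) ^ m)⁻¹)))) ^ 0) * ((2 * |β| * (L : ℝ) ^ 2 * Ss ^ 2) / (1 + (L : ℝ) / 4) ^ s)))) + (2 * (2 : ℕ) * (((2 * (∑ l ∈ range (j + 1), (j.choose l : ℝ) * ((((R.Gfr 0 * |U| * Θ * ((16 : ℝ) ^ m)⁻¹) * (R.Gfr 0 * |U| * Θ * ((16 : ℝ) ^ m)⁻¹) / |(β * (L : ℝ) ^ 2)|) * (8 * (|(β * (L : ℝ) ^ 2)| * (6 / (klScale klE0 m)))) * ((l ! : ℝ)) ^ 2 * (2 * (2 * (2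 ^ 10 * Φ * (4 : ℝ) ^ m) + 2 * (4 * (2 * (4 * (4 + (4 : ℝ) ^ m * Ξ) * (1 + 16 * (1 + 342) / (klScale klE0 m) * 1) + (2 ^ 10 * Φ * (4 : ℝ) ^ m))) * (1 + 6 / (klScale klE0 m) * ((klScale klE0 m) / 128 + 8 * (R.Gfr 0 * |U| * Θ * ((16 : ℝ) ^ m)⁻¹)))))) ^ l) * (1 / 4 : ℝ))) + 2 * (2 * ((1 / 4 : ℝ) * ((3 : ℝ) ^ j * (((R.Gfr 0 * |U| * Θ * ((16 : ℝ) ^ m)⁻¹) * (R.Gfr 0 * |U| * Θ * ((16 : ℝ) ^ m)⁻¹) / |(β * (L : ℝ) ^ 2)|) * (8 * (|(β * (L : ℝ) ^ 2)| * (6 / (klScale klE0 m)))) * ((Md ! : ℝ)) ^ 2 * (2 * (2 * (2 ^ 10 * Φ * (4 : ℝ) ^ m) + 2 * (4 * (2 * (4 * (4 + (4 : ℝ) ^ m * Ξ) * (1 + 16 * (1 + 342) / (klScale klE0 m) * 1) + (2 ^ 10 * Φ * (4 : ℝ) ^ m))) * (1 + 6 / (klScale klE0 m) * ((klScale klE0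 m) / 128 + 8 * (R.Gfr 0 * |U| * Θ * ((16 : ℝ) ^ m)⁻¹)))))) ^ Md) * (2 / ((2 * (L / 4 + 1) : ℕ) : ℝ)) ^ (Md - j - 4) * (2 ^ 2 * ∑' k : Fin 2 → ℤ, ∏ c, (1 + (k c : ℝ) ^ 2)⁻¹))))) + (L : ℝ) ^ 2 * (L : ℝ) ^ j * ((((R.Gfr 0 * |U| * Θ * ((16 : ℝ) ^ m)⁻¹) * (R.Gfr 0 * |U| * Θ * ((16 : ℝ) ^ m)⁻¹) / |(β * (L : ℝ) ^ 2)|) * (8 * (|(β * (L : ℝ) ^ 2)| * (6 / (klScale klE0 m)))) * ((0 ! : ℝ)) ^ 2 * (2 * (2 * (2 ^ 10 * Φ * (4 : ℝ) ^ m) + 2 * (4 * (2 * (4 * (4 + (4 : ℝ) ^ m * Ξ) * (1 + 16 * (1 + 342) / (klScale klE0 m) * 1) + (2 ^ 10 * Φ * (4 : ℝ) ^ m))) * (1 + 6 / (klScale klE0 m) * ((klScale klE0 m) / 128 + 8 * (R.Gfr 0 * |U| * Θ * ((16 : ℝ) ^ m)⁻¹)))))) ^ 0) * ((1 / 4 :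 ℝ) / (1 + (L : ℝ) / 4) ^ s))) + ((2 * (∑ l ∈ range (j + 1), (j.choose l : ℝ) * ((((R.Gfr 0 * |U| * Θ * ((16 : ℝ) ^ m)⁻¹) / |(β * (L : ℝ) ^ 2)| * (8 * (|(β * (L : ℝ) ^ 2)| * (6 / (klScale klE0 m))))) * ((R.Gfr 0 * |U| * Θ * ((16 : ℝ) ^ m)⁻¹) / |(β * (L : ℝ) ^ 2)| * (8 * (|(β * (L : ℝ) ^ 2)| * (6 / (klScale klE0 m))))) * ((l ! : ℝ)) ^ 2 * (2 * (2 * (2 * (2 ^ 10 * Φ * (4 : ℝ) ^ m) + 2 * (4 * (2 * (4 * (4 + (4 : ℝ) ^ m * Ξ) * (1 + 16 * (1 + 342) / (klScale klE0 m) * 1) + (2 ^ 10 * Φ * (4 : ℝ) ^ m))) * (1 + 6 / (klScale klE0 m) * ((klScale klE0 m) / 128 + 8 * (R.Gfr 0 * |U| * Θ * ((16 : ℝ) ^ m)⁻¹))))))) ^ l + 2 * (((R.Gfr 0 * |U| * Θ * ((16 : ℝ) ^ m)⁻¹) / |(β * (L : ℝ) ^ 2)|) * (8 * (|(β * (L :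 ℝ) ^ 2)| * (6 / (klScale klE0 m)))) * ((l ! : ℝ)) ^ 2 * (2 * (2 * (2 ^ 10 * Φ * (4 : ℝ) ^ m) + 2 * (4 * (2 * (4 * (4 + (4 : ℝ) ^ m * Ξ) * (1 + 16 * (1 + 342) / (klScale klE0 m) * 1) + (2 ^ 10 * Φ * (4 : ℝ) ^ m))) * (1 + 6 / (klScale klE0 m) * ((klScale klE0 m) / 128 + 8 * (R.Gfr 0 * |U| * Θ * ((16 : ℝ) ^ m)⁻¹)))))) ^ l)) * (1 / 4 * S' (j - l)))) + 2 * (2 * ((1 / 4 * S' j) * ((3 : ℝ) ^ j * (((R.Gfr 0 * |U| * Θ * ((16 : ℝ) ^ m)⁻¹) / |(β * (L : ℝ) ^ 2)| * (8 * (|(β * (L : ℝ) ^ 2)| * (6 / (klScale klE0 m))))) * ((R.Gfr 0 * |U| * Θ * ((16 : ℝ) ^ m)⁻¹) / |(β * (L : ℝ) ^ 2)| * (8 * (|(β * (L : ℝ) ^ 2)| * (6 / (klScale klE0 m))))) * ((Md ! : ℝ)) ^ 2 * (2 * (2 * (2 * (2 ^ 10 * Φ * (4 : ℝ) ^ m)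 + 2 * (4 * (2 * (4 * (4 + (4 : ℝ) ^ m * Ξ) * (1 + 16 * (1 + 342) / (klScale klE0 m) * 1) + (2 ^ 10 * Φ * (4 : ℝ) ^ m))) * (1 + 6 / (klScale klE0 m) * ((klScale klE0 m) / 128 + 8 * (R.Gfr 0 * |U| * Θ * ((16 : ℝ) ^ m)⁻¹))))))) ^ Md + 2 * (((R.Gfr 0 * |U| * Θ * ((16 : ℝ) ^ m)⁻¹) / |(β * (L : ℝ) ^ 2)|) * (8 * (|(β * (L : ℝ) ^ 2)| * (6 / (klScale klE0 m)))) * ((Md ! : ℝ)) ^ 2 * (2 * (2 * (2 ^ 10 * Φ * (4 : ℝ) ^ m) + 2 * (4 * (2 * (4 * (4 + (4 : ℝ) ^ m * Ξ) * (1 + 16 * (1 + 342) / (klScale klE0 m) * 1) + (2 ^ 10 * Φ * (4 : ℝ) ^ m))) * (1 + 6 / (klScale klE0 m) * ((klScale klE0 m) / 128 + 8 * (R.Gfr 0 * |U| * Θ * ((16 : ℝ) ^ m)⁻¹)))))) ^ Md)) * (2 / ((2 * (L / 4 + 1) : ℕ) : ℝ)) ^ (Md - j - 4) * (2 ^ 2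 * ∑' k : Fin 2 → ℤ, ∏ c, (1 + (k c : ℝ) ^ 2)⁻¹))))) + (L : ℝ) ^ 2 * (L : ℝ) ^ j * ((((R.Gfr 0 * |U| * Θ * ((16 : ℝ) ^ m)⁻¹) / |(β * (L : ℝ) ^ 2)| * (8 * (|(β * (L : ℝ) ^ 2)| * (6 / (klScale klE0 m))))) * ((R.Gfr 0 * |U| * Θ * ((16 : ℝ) ^ m)⁻¹) / |(β * (L : ℝ) ^ 2)| * (8 * (|(β * (L : ℝ) ^ 2)| * (6 / (klScale klE0 m))))) * ((0 ! : ℝ)) ^ 2 * (2 * (2 * (2 * (2 ^ 10 * Φ * (4 : ℝ) ^ m) + 2 * (4 * (2 * (4 * (4 + (4 : ℝ) ^ m * Ξ) * (1 + 16 * (1 + 342) / (klScale klE0 m) * 1) + (2 ^ 10 * Φ * (4 : ℝ) ^ m))) * (1 + 6 / (klScale klE0 m) * ((klScale klE0 m) / 128 + 8 * (R.Gfr 0 * |U| * Θ * ((16 : ℝ) ^ m)⁻¹))))))) ^ 0 + 2 * (((R.Gfr 0 * |U| * Θ * ((16 : ℝ) ^ m)⁻¹) / |(β * (L : ℝ)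 ^ 2)|) * (8 * (|(β * (L : ℝ) ^ 2)| * (6 / (klScale klE0 m)))) * ((0 ! : ℝ)) ^ 2 * (2 * (2 * (2 ^ 10 * Φ * (4 : ℝ) ^ m) + 2 * (4 * (2 * (4 * (4 + (4 : ℝ) ^ m * Ξ) * (1 + 16 * (1 + 342) / (klScale klE0 m) * 1) + (2 ^ 10 * Φ * (4 : ℝ) ^ m))) * (1 + 6 / (klScale klE0 m) * ((klScale klE0 m) / 128 + 8 * (R.Gfr 0 * |U| * Θ * ((16 : ℝ) ^ m)⁻¹)))))) ^ 0)) * ((1 / 4 * Ss') / (1 + (L : ℝ) / 4) ^ s))))) :=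
  norm_iteratedFDeriv_klLocSelfEnergyRe_flowFrame_sub_le_aliasing_graded_gevrey_small hβ U μ m hRG hGS hQS hμ hOK₁ hOK₂ (by norm_num)
    abs_deriv_salmhoferCutoff_le_four hfdist hfd hZ₂ hZ j q hN0 hN hM hRmom hSE salmhoferCutoff_flat_table_four
    (by norm_num) (by norm_num) (salmhoferCutoff_gevrey_table Md) hP hTJ hmn hΞ0 hΘ0 hΦ0 hΞ hΘΦ hδΛ hωΛ

end Flow

end Summit.HubbardSuperconductivity.HubbardSuperconductivity.Theorems.EngineV8

end
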